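import Summits.AtomisticToContinuum.HydrodynamicLimit.Theorems.ImplosionDichotomyHydroLimitInBandWindowContinuityFields
import Literature.MathematicalPhysics.KineticTheory.HardSphereEulerProofs
import HarnessLib

/-!
# Freeze bounds for Yau's entropy ledger — slab-calculus toolkit (stub `stub_flowShiftFreeze`, line
# `IdeatorTwoSketch`, crux `ClampedCurrentsDock`, stmt-AtomisticToContinuum-14680)

Helper file (`--supports stmt-AtomisticToContinuum-14680`) for the registered stub FS+FZ
`stub_flowShiftFreeze : WindowFlowShift ∧ FreezeBounds` of the lead's skeleton
(`Cruxes/ClampedCurrentsDock/Lines/IdeatorTwoSketch.lean`, §1d), proved in the companion file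
`OneFlightGossipEngineClampedCurrentsDockFlowShiftFreeze.lean` (which imports this one); split off for the
400-line limit. Deterministic calculus on the compact slab `[0, t] × 𝕋³`:

* §1 closure of joint smoothness `Torus.IsSmoothSpaceTimeOn` under inverse / quotient / powers, and
  smoothness of the hard-sphere compressibility factor `Z = hsCompressibility` and of `Z′` on an EOS window
  `(0, η₁)` on which `Z(η) = 1 + η F′(η)` with `F` analytic on `(−η₁, η₁)` (so `Z ∘ (ρσ³)`, `Z′ ∘ (ρσ³)` are
  jointly smooth along fields with packing in the window);
* §2 the weighted time-Lipschitz class `WLip t n f` of one-body functionals `f s x v`: bounded and Lipschitz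
  in the time `s ∈ [0, t]`, uniformly in `x ∈ 𝕋³`, with the velocity weight `(1 + |v|)ⁿ`; closed under sums,
  products (weights add) and division by jointly smooth non-vanishing fields; jointly smooth fields lie in
  `WLip t 0` (compactness + the mean value theorem in time with the one-sided derivative
  `Torus.timeDerivWithin`), velocity coordinates in `WLip t 1`, the peculiar kinetic energy in `WLip t 2`;
* §3 for a field jointly smooth on `[0, T) × 𝕋³` and `0 < t < T`: the spatial Lipschitz bound
  `|φ(s,x) − φ(s,x′)| ≤ K d(x,x′)` uniformly in `s ∈ [0, t]` and the MIXED bound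
  `|(φ(s₁,x) − φ(s₁,x′)) − (φ(s₂,x) − φ(s₂,x′))| ≤ K |s₁ − s₂| d(x,x′)` (`d = Torus.euclidDist`; mean value
  theorem in time for `s ↦ φ(s,x) − φ(s,x′)`, whose derivative `∂ₛφ(s,x) − ∂ₛφ(s,x′)` is `O(d(x,x′))` by
  the joint Lipschitz bound `HydroLimitInBandContinuity.exists_lipschitz_slab` of the smooth field `∂ₛφ`);
* §4 packaging of the polynomial weights `(1 + |v|)³ ≤ 4(1 + |v|³)`, `(1 + |v|)² ≤ 2(1 + |v|²)`.

prover-line-stmt-AtomisticToContinuum-14680-c2-0 (stub worker FS+FZ).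
-/

noncomputable section

open MeasureTheory Filter Set Topology
open scoped ContDiff

namespace Summit.AtomisticToContinuum.HydrodynamicLimit.Theorems.ClampedCurrentsDockFreezeToolkit

open Literature.MathematicalPhysics.KineticTheory Literature.Analysis.FluidPDE Literature.Analysis.FunctionSpaces
open Summit.AtomisticToContinuum.HydrodynamicLimit.Theorems.HydroLimitInBandContinuity

/-! ### §1 Joint smoothness: inverse, quotient, powers; the compressibility factor on an EOS window -/

section Smooth

variable {S : Set ℝ} {a b : ℝ → T3 → ℝ}

/-- Constant fields are jointly smooth. [folklore] -/
theorem sst_const (S : Set ℝ) (c : ℝ) : Torus.IsSmoothSpaceTimeOn S (fun (_ : ℝ) (_ : T3) => c) :=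
  contDiffOn_const

/-- The inverse of a non-vanishing jointly smooth scalar field is jointly smooth. [folklore] -/
theorem sst_inv (ha : Torus.IsSmoothSpaceTimeOn S a) (h0 : ∀ s ∈ S, ∀ x, a s x ≠ 0) :
    Torus.IsSmoothSpaceTimeOn S (fun s x => (a s x)⁻¹) := by
  show ContDiffOn ℝ _ (fun p : ℝ × V3 => (Torus.stLift a p)⁻¹) (S ×ˢ univ)
  exact ContDiffOn.inv ha fun p hp => h0 p.1 (mem_prod.1 hp).1 _

/-- The quotient of jointly smooth scalar fields (non-vanishing denominator) is jointly smooth. [folklore] -/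
theorem sst_div (ha : Torus.IsSmoothSpaceTimeOn S a) (hb : Torus.IsSmoothSpaceTimeOn S b)
    (h0 : ∀ s ∈ S, ∀ x, b s x ≠ 0) : Torus.IsSmoothSpaceTimeOn S (fun s x => a s x / b s x) := by
  show ContDiffOn ℝ _ (fun p : ℝ × V3 => Torus.stLift a p / Torus.stLift b p) (S ×ˢ univ)
  exact ContDiffOn.div ha hb fun p hp => h0 p.1 (mem_prod.1 hp).1 _

/-- Powers of a jointly smooth scalar field are jointly smooth. [folklore] -/
theorem sst_pow (ha : Torus.IsSmoothSpaceTimeOn S a) (n : ℕ) :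
    Torus.IsSmoothSpaceTimeOn S (fun s x => a s x ^ n) := by
  show ContDiffOn ℝ _ (fun p : ℝ × V3 => Torus.stLift a p ^ n) (S ×ˢ univ)
  exact ContDiffOn.pow ha n

/-- **The compressibility factor is smooth on an EOS window, with smooth derivative.** If
`hsCompressibility η = 1 + η F′(η)` on `(0, η₁)` for an `F` analytic on `(−η₁, η₁)`, then `hsCompressibility`
and `deriv hsCompressibility` are `C^∞` on `(0, η₁)` (both agree there, locally, with the analytic
`η ↦ 1 + η F′(η)` and its derivative, `Filter.EventuallyEq.deriv_eq`). [folklore] -/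
theorem contDiffOn_hsCompressibility {η₁ : ℝ} {F : ℝ → ℝ} (hF : AnalyticOnNhd ℝ F (Ioo (-η₁) η₁))
    (hZ : ∀ η ∈ Ioo 0 η₁, hsCompressibility η = 1 + η * deriv F η) :
    ContDiffOn ℝ ∞ hsCompressibility (Ioo 0 η₁) ∧
      ContDiffOn ℝ ∞ (deriv hsCompressibility) (Ioo 0 η₁) := by
  set Zf : ℝ → ℝ := fun η => 1 + η * deriv F η with hZf
  have hZc : ContDiffOn ℝ ∞ Zf (Ioo (-η₁) η₁) :=
    contDiffOn_const.add (contDiffOn_id.mul hF.deriv.contDiffOn_of_completeSpace)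
  have hsub : Ioo 0 η₁ ⊆ Ioo (-η₁) η₁ := fun η hη => ⟨by linarith [hη.1, hη.2], hη.2⟩
  have hev : ∀ η ∈ Ioo 0 η₁, hsCompressibility =ᶠ[𝓝 η] Zf := fun η hη =>
    Filter.eventuallyEq_of_mem (Ioo_mem_nhds hη.1 hη.2) fun η' hη' => hZ η' hη'
  exact ⟨(hZc.mono hsub).congr fun η hη => hZ η hη,
    ((hZc.deriv_of_isOpen isOpen_Ioo le_rfl).mono hsub).congr fun η hη => (hev η hη).deriv_eq⟩

/-- Along a jointly smooth density with packing `ρσ³ ∈ (0, η₁)` on the time set, `Z(ρσ³)` and `Z′(ρσ³)` are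
jointly smooth (composition with the smooth EOS of `contDiffOn_hsCompressibility`). [folklore] -/
theorem sst_hsCompressibility_comp {η₁ σ : ℝ} {F : ℝ → ℝ} {ρ : ℝ → T3 → ℝ}
    (hF : AnalyticOnNhd ℝ F (Ioo (-η₁) η₁)) (hZ : ∀ η ∈ Ioo 0 η₁, hsCompressibility η = 1 + η * deriv F η)
    (hρ : Torus.IsSmoothSpaceTimeOn S ρ) (hr : ∀ s ∈ S, ∀ x, ρ s x * σ ^ 3 ∈ Ioo 0 η₁) :
    Torus.IsSmoothSpaceTimeOn S (fun s x => hsCompressibility (ρ s x * σ ^ 3)) ∧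
      Torus.IsSmoothSpaceTimeOn S (fun s x => deriv hsCompressibility (ρ s x * σ ^ 3)) := by
  obtain ⟨h1, h2⟩ := contDiffOn_hsCompressibility hF hZ
  have hP : Torus.IsSmoothSpaceTimeOn S (fun s x => ρ s x * σ ^ 3) := hρ.mul (sst_const S (σ ^ 3))
  have hmaps : MapsTo (Torus.stLift fun s x => ρ s x * σ ^ 3) (S ×ˢ (univ : Set V3)) (Ioo 0 η₁) :=
    fun p hp => hr p.1 (mem_prod.1 hp).1 _
  exact ⟨h1.comp hP hmaps, h2.comp hP hmaps⟩

end Smooth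

/-! ### §2 The weighted time-Lipschitz class -/

/-- The **weighted time-Lipschitz class** of one-body functionals on the slab `[0, t] × 𝕋³ × ℝ³`, AS DATA: a
constant `C ≥ 0` with `|f s x v| ≤ C (1 + |v|)ⁿ` and `|f s₁ x v − f s₂ x v| ≤ C |s₁ − s₂| (1 + |v|)ⁿ` for
`s, s₁, s₂ ∈ [0, t]` (bounded and Lipschitz in time, uniformly in `x`, with the velocity weight `(1 + |v|)ⁿ`).
Route-internal bookkeeping gadget, not a cited notion. -/
structure WLip (t : ℝ) (n : ℕ) (f : ℝ → T3 → V3 → ℝ) where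
  /-- The common constant of the two bounds. -/
  C : ℝ
  /-- The constant is nonnegative. -/
  nonneg : 0 ≤ C
  /-- The weighted bound and the weighted time-Lipschitz bound on the slab. -/
  bound : ∀ s₁ ∈ Icc (0 : ℝ) t, ∀ s₂ ∈ Icc (0 : ℝ) t, ∀ (x : T3) (v : V3),
    |f s₁ x v| ≤ C * (1 + ‖v‖) ^ n ∧ |f s₁ x v - f s₂ x v| ≤ C * |s₁ - s₂| * (1 + ‖v‖) ^ n

namespace WLip

variable {t : ℝ} {m n k : ℕ} {f g : ℝ → T3 → V3 → ℝ}

/-- From an existence statement to the gadget (choice). [folklore] -/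
def ofExists (h : ∃ C : ℝ, 0 ≤ C ∧ ∀ s₁ ∈ Icc (0 : ℝ) t, ∀ s₂ ∈ Icc (0 : ℝ) t, ∀ (x : T3) (v : V3),
    |f s₁ x v| ≤ C * (1 + ‖v‖) ^ n ∧ |f s₁ x v - f s₂ x v| ≤ C * |s₁ - s₂| * (1 + ‖v‖) ^ n) : WLip t n f :=
  ⟨h.choose, h.choose_spec.1, h.choose_spec.2⟩

/-- Transport along pointwise equality on the slab. [folklore] -/
def congr (hf : WLip t n f) (h : ∀ s ∈ Icc (0 : ℝ) t, ∀ x v, f s x v = g s x v) : WLip t n g where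
  C := hf.C
  nonneg := hf.nonneg
  bound s₁ hs₁ s₂ hs₂ x v := by
    rw [← h s₁ hs₁, ← h s₂ hs₂]
    exact hf.bound s₁ hs₁ s₂ hs₂ x v

/-- Raising the weight. [folklore] -/
def mono (hf : WLip t m f) (hmn : m ≤ n) : WLip t n f where
  C := hf.C
  nonneg := hf.nonneg
  bound s₁ hs₁ s₂ hs₂ x v := by
    obtain ⟨h1, h2⟩ := hf.bound s₁ hs₁ s₂ hs₂ x v
    have hP : (1 + ‖v‖) ^ m ≤ (1 + ‖v‖) ^ n :=
      pow_le_pow_right₀ (le_add_of_nonneg_right (norm_nonneg v)) hmn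
    exact ⟨h1.trans (mul_le_mul_of_nonneg_left hP hf.nonneg),
      h2.trans (mul_le_mul_of_nonneg_left hP (mul_nonneg hf.nonneg (abs_nonneg _)))⟩

/-- Sums stay in the class. [folklore] -/
def add (hf : WLip t n f) (hg : WLip t n g) : WLip t n fun s x v => f s x v + g s x v where
  C := hf.C + hg.C
  nonneg := add_nonneg hf.nonneg hg.nonneg
  bound s₁ hs₁ s₂ hs₂ x v := by
    obtain ⟨h1, h2⟩ := hf.bound s₁ hs₁ s₂ hs₂ x v
    obtain ⟨h3, h4⟩ := hg.bound s₁ hs₁ s₂ hs₂ x v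
    constructor
    · rw [add_mul]
      exact (abs_add_le _ _).trans (add_le_add h1 h3)
    · rw [add_sub_add_comm, add_mul, add_mul]
      exact (abs_add_le _ _).trans (add_le_add h2 h4)

/-- Negatives stay in the class. [folklore] -/
def neg (hf : WLip t n f) : WLip t n fun s x v => -f s x v where
  C := hf.C
  nonneg := hf.nonneg
  bound s₁ hs₁ s₂ hs₂ x v := by
    obtain ⟨h1, h2⟩ := hf.bound s₁ hs₁ s₂ hs₂ x v
    refine ⟨by rwa [abs_neg], ?_⟩
    rwa [show -f s₁ x v - -f s₂ x v = -(f s₁ x v - f s₂ x v) by ring, abs_neg]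

/-- Differences stay in the class. [folklore] -/
def sub (hf : WLip t n f) (hg : WLip t n g) : WLip t n fun s x v => f s x v - g s x v :=
  (hf.add hg.neg).congr fun _ _ _ _ => by ring

/-- Constants have weight `0`. [folklore] -/
def const (t c : ℝ) : WLip t 0 fun _ _ _ => c where
  C := |c|
  nonneg := abs_nonneg c
  bound s₁ _ s₂ _ _ v := ⟨by simp, by simp only [sub_self, abs_zero, pow_zero, mul_one]; positivity⟩

/-- Velocity coordinates have weight `1`. [folklore] -/
def coord (t : ℝ) (j : Fin 3) : WLip t 1 fun _ _ v => v j where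
  C := 1
  nonneg := zero_le_one
  bound s₁ _ s₂ _ _ v := by
    refine ⟨?_, by simp only [sub_self, abs_zero, pow_one]; positivity⟩
    have h : |v j| ≤ ‖v‖ := by simpa using PiLp.norm_apply_le v j
    rw [one_mul, pow_one]
    linarith [norm_nonneg v]

/-- Products: the weights add. [folklore] -/
def mul (hf : WLip t m f) (hg : WLip t n g) : WLip t (m + n) fun s x v => f s x v * g s x v where
  C := 2 * hf.C * hg.C
  nonneg := mul_nonneg (mul_nonneg zero_le_two hf.nonneg) hg.nonneg
  bound s₁ hs₁ s₂ hs₂ x v := by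
    obtain ⟨h1, h2⟩ := hf.bound s₁ hs₁ s₂ hs₂ x v
    obtain ⟨h3, -⟩ := hf.bound s₂ hs₂ s₁ hs₁ x v
    obtain ⟨h4, h5⟩ := hg.bound s₁ hs₁ s₂ hs₂ x v
    have hC := hf.nonneg
    have hD := hg.nonneg
    have hP0 : 0 ≤ (1 + ‖v‖) ^ m := by positivity
    have h0 : 0 ≤ hf.C * (1 + ‖v‖) ^ m * (hg.C * (1 + ‖v‖) ^ n) := by positivity
    constructor
    · rw [abs_mul, pow_add]
      calc |f s₁ x v| * |g s₁ x v| ≤ hf.C * (1 + ‖v‖) ^ m * (hg.C * (1 + ‖v‖) ^ n) :=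
            mul_le_mul h1 h4 (abs_nonneg _) (mul_nonneg hC hP0)
        _ ≤ 2 * hf.C * hg.C * ((1 + ‖v‖) ^ m * (1 + ‖v‖) ^ n) := by linarith
    · rw [show f s₁ x v * g s₁ x v - f s₂ x v * g s₂ x v =
          (f s₁ x v - f s₂ x v) * g s₁ x v + f s₂ x v * (g s₁ x v - g s₂ x v) by ring, pow_add]
      refine (abs_add_le _ _).trans ?_
      rw [abs_mul, abs_mul]
      calc |f s₁ x v - f s₂ x v| * |g s₁ x v| + |f s₂ x v| * |g s₁ x v - g s₂ x v|
          ≤ hf.C * |s₁ - s₂| * (1 + ‖v‖) ^ m * (hg.C * (1 + ‖v‖) ^ n) +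
              hf.C * (1 + ‖v‖) ^ m * (hg.C * |s₁ - s₂| * (1 + ‖v‖) ^ n) :=
            add_le_add (mul_le_mul h2 h4 (abs_nonneg _) (by positivity))
              (mul_le_mul h3 h5 (abs_nonneg _) (mul_nonneg hC hP0))
        _ = 2 * hf.C * hg.C * |s₁ - s₂| * ((1 + ‖v‖) ^ m * (1 + ‖v‖) ^ n) := by ring

/-- Products, with the weight raised to any `k ≥ m + n`. [folklore] -/
def mul' (hf : WLip t m f) (hg : WLip t n g) (hk : m + n ≤ k) : WLip t k fun s x v => f s x v * g s x v :=
  (hf.mul hg).mono hk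

/-- Finite sums stay in the class. [folklore] -/
def sum {ι : Type*} (S : Finset ι) {G : ι → ℝ → T3 → V3 → ℝ} (hG : ∀ i, WLip t n (G i)) :
    WLip t n fun s x v => ∑ i ∈ S, G i s x v where
  C := ∑ i ∈ S, (hG i).C
  nonneg := Finset.sum_nonneg fun i _ => (hG i).nonneg
  bound s₁ hs₁ s₂ hs₂ x v := by
    constructor
    · rw [Finset.sum_mul]
      exact (Finset.abs_sum_le_sum_abs _ _).trans
        (Finset.sum_le_sum fun i _ => ((hG i).bound s₁ hs₁ s₂ hs₂ x v).1)
    · rw [← Finset.sum_sub_distrib, Finset.sum_mul, Finset.sum_mul]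
      exact (Finset.abs_sum_le_sum_abs _ _).trans
        (Finset.sum_le_sum fun i _ => ((hG i).bound s₁ hs₁ s₂ hs₂ x v).2)

/-- Branching on a fixed proposition. [folklore] -/
def ite {p : Prop} [Decidable p] (hf : WLip t n f) (hg : WLip t n g) :
    WLip t n fun s x v => if p then f s x v else g s x v :=
  if hp : p then hf.congr fun _ _ _ _ => by rw [if_pos hp] else hg.congr fun _ _ _ _ => by rw [if_neg hp]

/-- **Jointly smooth fields on the slab `[0, t] × 𝕋³` (`0 < t`) are bounded and time-Lipschitz, uniformly in
space** (compactness for the bound; mean value theorem in time, the one-sided time derivative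
`Torus.timeDerivWithin` being jointly smooth hence bounded on the slab). [folklore] -/
theorem exists_bound_lipschitz_of_smooth (ht : 0 < t) {φ : ℝ → T3 → ℝ}
    (hφ : Torus.IsSmoothSpaceTimeOn (Icc 0 t) φ) :
    ∃ C : ℝ, 0 ≤ C ∧ ∀ s₁ ∈ Icc (0 : ℝ) t, ∀ s₂ ∈ Icc (0 : ℝ) t, ∀ (x : T3) (v : V3),
      |φ s₁ x| ≤ C * (1 + ‖v‖) ^ 0 ∧ |φ s₁ x - φ s₂ x| ≤ C * |s₁ - s₂| * (1 + ‖v‖) ^ 0 := by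
  have hU : UniqueDiffOn ℝ (Icc (0 : ℝ) t) := uniqueDiffOn_Icc ht
  obtain ⟨B, hB⟩ := hφ.exists_norm_le_of_isCompact isCompact_Icc subset_rfl
  obtain ⟨L, hL⟩ := (hφ.timeDerivWithin hU).exists_norm_le_of_isCompact isCompact_Icc subset_rfl
  refine ⟨|B| + |L|, by positivity, fun s₁ hs₁ s₂ hs₂ x v => ⟨?_, ?_⟩⟩
  · have h := hB s₁ hs₁ x
    rw [Real.norm_eq_abs] at h
    rw [pow_zero, mul_one]
    exact h.trans ((le_abs_self B).trans (le_add_of_nonneg_right (abs_nonneg L)))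
  · have h := (convex_Icc (0 : ℝ) t).norm_image_sub_le_of_norm_hasDerivWithin_le
      (f := fun τ => φ τ x) (fun r hr => hφ.hasDerivWithinAt_slice hr x)
      (fun r hr => (hL r hr x).trans (le_abs_self L)) hs₂ hs₁
    rw [Real.norm_eq_abs, Real.norm_eq_abs] at h
    rw [pow_zero, mul_one, add_mul]
    exact h.trans (le_add_of_nonneg_left (mul_nonneg (abs_nonneg B) (abs_nonneg _)))

/-- Jointly smooth fields on the slab have weight `0`. [folklore] -/
def of_smooth (ht : 0 < t) {φ : ℝ → T3 → ℝ} (hφ : Torus.IsSmoothSpaceTimeOn (Icc 0 t) φ) :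
    WLip t 0 fun s x _ => φ s x :=
  ofExists (exists_bound_lipschitz_of_smooth ht hφ)

/-- Division by a jointly smooth non-vanishing field on the slab keeps the weight. [folklore] -/
def div_smooth (hf : WLip t n f) (ht : 0 < t) {φ : ℝ → T3 → ℝ}
    (hφ : Torus.IsSmoothSpaceTimeOn (Icc 0 t) φ) (h0 : ∀ s ∈ Icc (0 : ℝ) t, ∀ x, φ s x ≠ 0) :
    WLip t n fun s x v => f s x v / φ s x :=
  (hf.mul' (of_smooth ht (sst_inv hφ h0)) le_rfl).congr fun _ _ _ _ => by rw [div_eq_mul_inv]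

/-- The coordinates of the peculiar velocity `v − u(s, x)` (`u` jointly smooth on the slab) have weight `1`.
[folklore] -/
def sub_field (ht : 0 < t) {u : ℝ → T3 → V3} (hu : Torus.IsSmoothSpaceTimeOn (Icc 0 t) u) (j : Fin 3) :
    WLip t 1 fun s x v => (v - u s x) j :=
  ((coord t j).sub ((of_smooth ht (hu.apply j)).mono zero_le_one)).congr fun _ _ _ _ => by
    rw [PiLp.sub_apply]

/-- The peculiar kinetic energy `|v − u(s, x)|²` has weight `2`. [folklore] -/
def norm_sub_sq (ht : 0 < t) {u : ℝ → T3 → V3} (hu : Torus.IsSmoothSpaceTimeOn (Icc 0 t) u) :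
    WLip t 2 fun s x v => ‖v - u s x‖ ^ 2 :=
  (sum Finset.univ fun j => (sub_field ht hu j).mul' (sub_field ht hu j) le_rfl).congr fun _ _ _ v => by
    rw [EuclideanSpace.real_norm_sq_eq]
    exact Finset.sum_congr rfl fun j _ => (sq _).symm

end WLip

/-! ### §3 Spatial and mixed Lipschitz bounds of jointly smooth fields on a compact slab -/

/-- **Spatial Lipschitz bound, uniformly in time**: a field jointly smooth on `[0, T) × 𝕋³` satisfies
`|φ(s,x) − φ(s,x′)| ≤ K d(x, x′)` for `s ∈ [0, t]`, `0 < t < T` (the joint bound `exists_lipschitz_slab` at equal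
times; `d` the minimal-image distance). [folklore] -/
theorem exists_spatial_lipschitz {T t : ℝ} {φ : ℝ → T3 → ℝ} (hφ : Torus.IsSmoothSpaceTimeOn (Ico 0 T) φ)
    (ht : 0 < t) (htT : t < T) :
    ∃ K : ℝ, 0 ≤ K ∧ ∀ s ∈ Icc 0 t, ∀ x x' : T3, |φ s x - φ s x'| ≤ K * Torus.euclidDist x x' := by
  obtain ⟨K, hK, h⟩ := exists_lipschitz_slab hφ ht htT
  refine ⟨K, hK, fun s hs x x' => ?_⟩
  have h' := h s hs s hs x x'
  rwa [sub_self, abs_zero, zero_add, Real.norm_eq_abs] at h'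

/-- **Mixed time–space bound.** A field jointly smooth on `[0, T) × 𝕋³` satisfies, for `0 < t < T` and
`s₁, s₂ ∈ [0, t]`, `|(φ(s₁,x) − φ(s₁,x′)) − (φ(s₂,x) − φ(s₂,x′))| ≤ K |s₁ − s₂| d(x, x′)`: the mean value
theorem in time for `s ↦ φ(s,x) − φ(s,x′)`, whose one-sided derivative `∂ₛφ(s,x) − ∂ₛφ(s,x′)` is bounded by
`K d(x,x′)` (joint Lipschitz bound `exists_lipschitz_slab` of the jointly smooth field `∂ₛφ`). [folklore] -/
theorem exists_mixed_lipschitz {T t : ℝ} {φ : ℝ → T3 → ℝ} (hφ : Torus.IsSmoothSpaceTimeOn (Ico 0 T) φ)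
    (ht : 0 < t) (htT : t < T) :
    ∃ K : ℝ, 0 ≤ K ∧ ∀ s₁ ∈ Icc 0 t, ∀ s₂ ∈ Icc 0 t, ∀ x x' : T3,
      |(φ s₁ x - φ s₁ x') - (φ s₂ x - φ s₂ x')| ≤ K * |s₁ - s₂| * Torus.euclidDist x x' := by
  have hU : UniqueDiffOn ℝ (Ico (0 : ℝ) T) := uniqueDiffOn_Ico 0 T
  have hsub : Icc 0 t ⊆ Ico 0 T := Icc_subset_Ico_right htT
  obtain ⟨K, hK, h⟩ := exists_lipschitz_slab (hφ.timeDerivWithin hU) ht htT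
  refine ⟨K, hK, fun s₁ hs₁ s₂ hs₂ x x' => ?_⟩
  have hd : ∀ r ∈ Icc (0 : ℝ) t, HasDerivWithinAt (fun τ => φ τ x - φ τ x')
      (Torus.timeDerivWithin (Ico 0 T) φ r x - Torus.timeDerivWithin (Ico 0 T) φ r x') (Icc 0 t) r :=
    fun r hr => ((hφ.hasDerivWithinAt_slice (hsub hr) x).mono hsub).sub
      ((hφ.hasDerivWithinAt_slice (hsub hr) x').mono hsub)
  have hb : ∀ r ∈ Icc (0 : ℝ) t, ‖Torus.timeDerivWithin (Ico 0 T) φ r x -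
      Torus.timeDerivWithin (Ico 0 T) φ r x'‖ ≤ K * Torus.euclidDist x x' := fun r hr => by
    have h' := h r hr r hr x x'
    rwa [sub_self, abs_zero, zero_add] at h'
  have hm := (convex_Icc (0 : ℝ) t).norm_image_sub_le_of_norm_hasDerivWithin_le hd hb hs₂ hs₁
  rw [Real.norm_eq_abs, Real.norm_eq_abs] at hm
  calc |(φ s₁ x - φ s₁ x') - (φ s₂ x - φ s₂ x')| ≤ K * Torus.euclidDist x x' * |s₁ - s₂| := hm
    _ = K * |s₁ - s₂| * Torus.euclidDist x x' := by ring

/-! ### §4 Packaging of the velocity weights -/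

/-- `(1 + a)³ ≤ 4 (1 + a³)` for `a ≥ 0` (`4(1 + a³) − (1 + a)³ = 3 (1 − a)² (1 + a)`). [folklore] -/
theorem one_add_pow_three_le {a : ℝ} (ha : 0 ≤ a) : (1 + a) ^ 3 ≤ 4 * (1 + a ^ 3) := by
  nlinarith [mul_nonneg (sq_nonneg (1 - a)) (by linarith : (0 : ℝ) ≤ 1 + a)]

/-- `(1 + a)² ≤ 2 (1 + a²)`. [folklore] -/
theorem one_add_pow_two_le (a : ℝ) : (1 + a) ^ 2 ≤ 2 * (1 + a ^ 2) := by
  nlinarith [sq_nonneg (1 - a)]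

/-- From a `WLip t 3` increment bound to the cubic weight `1 + |v|³`, with any constant `C ≥ 4 C₁`. [folklore] -/
theorem le_weight_three {a C₁ C d r : ℝ} (h : a ≤ C₁ * d * (1 + r) ^ 3) (hC₁ : 0 ≤ C₁) (hC : 4 * C₁ ≤ C)
    (hd : 0 ≤ d) (hr : 0 ≤ r) : a ≤ C * d * (1 + r ^ 3) := by
  have h2 : 0 ≤ 1 + r ^ 3 := by positivity
  calc a ≤ C₁ * d * (1 + r) ^ 3 := h
    _ ≤ C₁ * d * (4 * (1 + r ^ 3)) := mul_le_mul_of_nonneg_left (one_add_pow_three_le hr) (mul_nonneg hC₁ hd)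
    _ = 4 * C₁ * d * (1 + r ^ 3) := by ring
    _ ≤ C * d * (1 + r ^ 3) := mul_le_mul_of_nonneg_right (mul_le_mul_of_nonneg_right hC hd) h2

/-- From a `WLip t 2` increment bound to the quadratic weight `1 + |v|²`, with any constant `C ≥ 2 C₁`.
[folklore] -/
theorem le_weight_two {a C₁ C d r : ℝ} (h : a ≤ C₁ * d * (1 + r) ^ 2) (hC₁ : 0 ≤ C₁) (hC : 2 * C₁ ≤ C)
    (hd : 0 ≤ d) : a ≤ C * d * (1 + r ^ 2) := by
  have h2 : 0 ≤ 1 + r ^ 2 := by positivity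
  calc a ≤ C₁ * d * (1 + r) ^ 2 := h
    _ ≤ C₁ * d * (2 * (1 + r ^ 2)) := mul_le_mul_of_nonneg_left (one_add_pow_two_le r) (mul_nonneg hC₁ hd)
    _ = 2 * C₁ * d * (1 + r ^ 2) := by ring
    _ ≤ C * d * (1 + r ^ 2) := mul_le_mul_of_nonneg_right (mul_le_mul_of_nonneg_right hC hd) h2

/-- The minimal-image distance is nonnegative. [folklore] -/
theorem euclidDist_nonneg (x x' : T3) : 0 ≤ Torus.euclidDist x x' := by
  rw [Torus.euclidDist_eq]; exact norm_nonneg _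

end Summit.AtomisticToContinuum.HydrodynamicLimit.Theorems.ClampedCurrentsDockFreezeToolkit

end
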